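import Literature.AlgebraicGeometry.HodgeTheory.FermatEigenspaceMultiplicityOne
import Literature.AlgebraicGeometry.HodgeTheory.FermatJuxtapositionSpans
import Literature.AlgebraicGeometry.HodgeTheory.FermatEigenspaceHodgeDecomposition
import Literature.AlgebraicGeometry.HodgeTheory.FermatFourfoldSemiDecomposableEigenlinesProofs
import Literature.AlgebraicGeometry.HodgeTheory.LefschetzOneOneHolds
import HarnessLib

/-!
# The printed supply of Shioda's induction on Fermat varieties: the leaves discharged so far, composed

Family `hodge`, layer `Literature/AlgebraicGeometry/HodgeTheory`. PROOF FILE (theorems only; no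
definition, no named fact; D-0026). Four of the five named facts of Aoki's claim(α) calculus
(`FermatInductiveClaims`: `Aoki1987_claim_juxtaposition`, `Aoki1987_claim_pStandard`;
`FermatSurfaceNeronSeveriEigenlines`: `AokiShioda1983_eigenline_le_neronSeveri`;
`FermatFourfoldSemiDecomposableEigenlines`: `Shioda1979_claim_semiDecomposable`) are reduced in the
tree to named leaves by `Aoki1987_claim_juxtaposition_holds_of`, `Aoki1987_claim_pStandard_holds_of`,
`AokiShioda1983_eigenline_le_neronSeveri_of_lefschetzOneOne_of_twoZero` / `_of_eigenforms` and
`Shioda1979_claim_semiDecomposable_of_join`. Two of those leaves are now THEOREMS of the tree: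

* (I) `dim V(α) ≤ 1` for admissible `α` (Ran 1980, Prop. 1.7 (i); Aoki 1987, p. 385) —
  `Ran1980_fermatEigenspace_le_span_holds` (`FermatEigenspaceMultiplicityOne`: Pham–Brieskorn join,
  Milnor Thm. 9.1, Thom–Gysin). The leaf `Ran1980_fermatEigenspace_rank_le_one` of
  `FermatJuxtapositionSpans` is the same statement letter for letter, so it is discharged here
  (`Ran1980_fermatEigenspace_rank_le_one_holds`).
* (L) Lefschetz's theorem on `(1,1)`-classes, rational form (Voisin I, Thm. 11.30) —
  `lefschetzOneOne_rational_holds` (`LefschetzOneOneHolds`: Kodaira–Serre count, GAGA).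

This file only composes: it records each of the four facts modulo EXACTLY its still-open leaves,
so that their residual obligations can be read off one declaration each —

* `Aoki1987_claim_juxtaposition_holds_of_spans` — Thm. 1-4 (i) from the four span facts
  (II) `Shioda1979_typeIISpan_represents`, (III) `Shioda1979_coneSpan_represents_left/right`,
  (IV) `Shioda1979_lines_represent` alone;
* `Aoki1987_claim_pStandard_holds_of_supportedClass` — Thm. 2-1 from its cohomological half
  `Aoki1987_thm_2_1_supportedClass` alone;
* `AokiShioda1983_eigenline_le_neronSeveri_holds_of_twoZero` / `_holds_of_eigenforms` — Aoki–Shioda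
  (2.1) from the vanishing of the `(2,0)`-parts of the Hodge eigenlines of the Fermat surface (resp.
  the absence of `χ_β`-eigen holomorphic `2`-forms, `β ∈ 𝔅²ₘ`) alone — in print Shioda (1.7) /
  Ran Prop. 1.7 (ii) for `n = 2`: the holomorphic `2`-forms `Res(x^a Ω/F)` have characters of
  length `1`;
* `Shioda1979_claim_semiDecomposable_holds_of_join` — the semi-decomposable sextuples from a
  representing ruled join alone (Ran §4).

It is a separate leaf so that the heavy, mutually independent import cones of (I) (Pham–Brieskorn)
and (L) (Kodaira–Serre, hard Lefschetz) meet only here.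

## References

* [Aoki1987] N. Aoki, Some new algebraic cycles on Fermat varieties, J. Math. Soc. Japan 39 (1987)
  385–396: p. 385 (`dim V(α) = 1`), p. 386, Thm. 1-4 (i) and Thm. 2-1 (p. 388).
* [Ran1980] Z. Ran, Cycles on Fermat hypersurfaces, Compositio Math. 42 (1980) 121–142, §1
  Prop. 1.7 (i)–(ii), §4 Cor. 4.7.
* [AokiShioda1983] N. Aoki, T. Shioda, Generators of the Néron–Severi group of a Fermat surface,
  Progr. Math. 35 (1983) 1–12, §2 (2.1).
* [Shioda1979PJA] T. Shioda, The Hodge conjecture and the Tate conjecture for Fermat varieties,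
  Proc. Japan Acad. 55A (1979) 111–114, §1 (iii), §4.
* [Shioda1979HodgeFermat] T. Shioda, The Hodge conjecture for Fermat varieties, Math. Ann. 245
  (1979) 175–184, §1 (1.7) and Thm. I.
* [VoisinHodgeI2002] C. Voisin, Hodge Theory and Complex Algebraic Geometry I, CUP 2002, Thm. 11.30.
-/

noncomputable section

open CategoryTheory AlgebraicGeometry MonoidalCategory Finset
open scoped Manifold ContDiff

namespace Literature.AlgebraicGeometry.HodgeTheory

open Literature.AlgebraicGeometry.Motives Literature.AlgebraicTopology.SingularHomology
  Literature.NumberTheory.Transcendental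

/-! ### (I) under its second name -/

/-- **`dim V(γ) ≤ 1` for admissible characters `γ` of `X²ᵠₘ`, `q > 0` — discharge of the named
fact `Ran1980_fermatEigenspace_rank_le_one`** (the hypothesis `hE1` of
`Aoki1987_claim_juxtaposition_holds_of`; Ran 1980, Prop. 1.7 (i); Aoki 1987, p. 385 "it is well
known that `dim V(α) = 1`"). It is, letter for letter, the named fact
`Ran1980_fermatEigenspace_le_span`, proved in the tree as `Ran1980_fermatEigenspace_le_span_holds`
(Pham–Brieskorn multiplicity one transported to `V(α)`). Relies on: nothing unproved.
[cite: Ran1980, §1 Prop. 1.7 (i)] [cite: Aoki1987, p. 385 (dim V(α) = 1)] -/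
theorem Ran1980_fermatEigenspace_rank_le_one_holds : Ran1980_fermatEigenspace_rank_le_one :=
  Ran1980_fermatEigenspace_le_span_holds

/-! ### Aoki 1987, Thm. 1-4 (i) modulo the span facts only -/

/-- **`Aoki1987_claim_juxtaposition` from its four GEOMETRIC leaves alone** (Aoki 1987, Thm. 1-4 (i);
Shioda 1979, Thm. I): the type-II spans (II), the cone spans (III, left and right) and the lines on
the Fermat surface (IV) representing `α∗β` imply claim(α) ∧ claim(β) ⟹ claim(α∗β) — the assembly
`Aoki1987_claim_juxtaposition_holds_of` with its first input (I) supplied by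
`Ran1980_fermatEigenspace_rank_le_one_holds`. Residual obligations of
`Aoki1987_claim_juxtaposition_holds`: exactly (II), (III-left), (III-right), (IV).
[cite: Aoki1987, Thm. 1-4 (i) p. 388 and p. 386] [cite: Shioda1979HodgeFermat, Thm. I] -/
theorem Aoki1987_claim_juxtaposition_holds_of_spans :
    Shioda1979_typeIISpan_represents → Shioda1979_coneSpan_represents_left →
      Shioda1979_coneSpan_represents_right → Shioda1979_lines_represent →
        Aoki1987_claim_juxtaposition :=
  Aoki1987_claim_juxtaposition_holds_of Ran1980_fermatEigenspace_rank_le_one_holds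

/-! ### Aoki 1987, Thm. 2-1 modulo its cohomological half only -/

/-- **`Aoki1987_claim_pStandard` from the cohomological half of Thm. 2-1 alone** (Aoki 1987,
Thm. 2-1: Aoki's variety `Y` represents `σ_{p,a}`): `Aoki1987_claim_pStandard_holds_of` with its
input (I) supplied by `Ran1980_fermatEigenspace_le_span_holds`. Residual obligation of
`Aoki1987_claim_pStandard_holds`: exactly `Aoki1987_thm_2_1_supportedClass` (a class supported on
`Y = Y_{c₀} ∩ X²ʳₘ` with non-zero `σ_{p,a}`-component; Aoki §§3–4).
[cite: Aoki1987, Thm. 2-1 (p. 388), Prop. 3-1 (p. 389) and p. 386] -/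
theorem Aoki1987_claim_pStandard_holds_of_supportedClass :
    Aoki1987_thm_2_1_supportedClass → Aoki1987_claim_pStandard :=
  Aoki1987_claim_pStandard_holds_of Ran1980_fermatEigenspace_le_span_holds

/-! ### Aoki–Shioda 1983, (2.1) modulo the `(2,0)`-parts of the Hodge eigenlines only -/

/-- **`AokiShioda1983_eigenline_le_neronSeveri` from the vanishing of the `(2,0)`-parts of the Hodge
eigenlines of the Fermat surface alone** (Aoki–Shioda 1983, (2.1) = Lefschetz `(1,1)` + Shioda's
Thm. I): if for every `m ≥ 1` and every `β ∈ 𝔅²ₘ` no non-zero class of `V(β) ⊂ H²(X²ₘ(ℂ); ℂ)` is of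
Hodge type `(2,0)` — in print: `V(β) ⊂ H^{1,1}` since `|β| = 2` (Shioda (1.7), Ran Prop. 1.7 (ii)) —
then every Hodge eigenline lies in `NS(X²ₘ) ⊗ ℂ`. This is
`AokiShioda1983_eigenline_le_neronSeveri_of_lefschetzOneOne_of_twoZero` with Lefschetz `(1,1)`
supplied by the theorem `lefschetzOneOne_rational_holds`. Residual obligation of
`AokiShioda1983_eigenline_le_neronSeveri_holds`: exactly the hypothesis `h20`.
[cite: AokiShioda1983, §2 (2.1)–(2.2), p. 3] [cite: Shioda1979HodgeFermat, §1 (1.7) and Thm. I]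
[cite: VoisinHodgeI2002, Thm. 11.30] -/
theorem AokiShioda1983_eigenline_le_neronSeveri_holds_of_twoZero
    (h20 : ∀ (m : ℕ) [NeZero m] (β : Fin 4 → ZMod m), FermatCharacter.IsHodge β →
      ∀ x ∈ fermatEigenspace m β 2, IsOfHodgeType 2 (fermatHypersurface 2 m) 2 2 0 x → x = 0) :
    AokiShioda1983_eigenline_le_neronSeveri :=
  AokiShioda1983_eigenline_le_neronSeveri_of_lefschetzOneOne_of_twoZero lefschetzOneOne_rational_holds
    h20

/-- **`AokiShioda1983_eigenline_le_neronSeveri` from the absence of `χ_β`-eigen holomorphic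
`2`-forms, `β ∈ 𝔅²ₘ`, alone** (form level of the previous statement): if for every `m ≥ 1` some
Hodge model `A` of `X²ₘ` has no non-zero smooth closed `(2,0)`-form `η` with
`(g_a^an)^* η = χ_β(a) η` for all `a ∈ μₘ⁴`, for every `β ∈ 𝔅²ₘ` — in print: the holomorphic
`2`-forms of the Fermat surface are the residues `Res(x^a Ω/F)`, `Σ aᵢ = m - 4`, of characters
`(a₀+1, …, a₃+1)` of length `1`, none of length `2` — then every Hodge eigenline lies in
`NS(X²ₘ) ⊗ ℂ`. This is `AokiShioda1983_eigenline_le_neronSeveri_of_lefschetzOneOne_of_eigenforms`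
with Lefschetz `(1,1)` supplied by `lefschetzOneOne_rational_holds`. Residual obligation of
`AokiShioda1983_eigenline_le_neronSeveri_holds`: exactly the hypothesis `hforms`.
[cite: AokiShioda1983, §2 (2.1)–(2.2), p. 3] [cite: Shioda1979HodgeFermat, §1 (1.7) and Thm. I]
[cite: VoisinHodgeI2002, Thm. 11.30] -/
theorem AokiShioda1983_eigenline_le_neronSeveri_holds_of_eigenforms
    (hforms : ∀ (m : ℕ) [NeZero m], ∃ A : HodgeModel 2 (fermatHypersurface 2 m),
      ∀ β : Fin 4 → ZMod m, FermatCharacter.IsHodge β →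
        ∀ η : Literature.Geometry.Kaehler.MForm 𝓘(ℝ, A.model) A.carrier ℂ 2,
          Literature.Geometry.Kaehler.IsSmoothForm η → Literature.Geometry.Kaehler.IsClosedForm η →
          IsOfType 2 0 η →
          (∀ a : fermatGroup 2 m, η.pullback 𝓘(ℝ, A.model)
            (HodgeModel.anMap A A (diagonalAut (fermatPolynomial ℂ 2 m)
              (fermatGroup_le_diagonalStabilizer m a.2))) =
              ((fermatCharacter m β a : ℂˣ) : ℂ) • η) → η = 0) :
    AokiShioda1983_eigenline_le_neronSeveri :=
  AokiShioda1983_eigenline_le_neronSeveri_of_lefschetzOneOne_of_eigenforms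
    lefschetzOneOne_rational_holds hforms

/-! ### Shioda 1979, semi-decomposable sextuples modulo a representing ruled join only -/

/-- **`Shioda1979_claim_semiDecomposable` from a representing ruled join alone** (Ran 1980, §4:
"if `c′` and `c″` are algebraic then so is `c′ ∗ c″`", Cor. 4.7 `H_{χ′} ∗ H_{χ″} = H_{χ′∗χ″}`; Aoki
p. 386 "represents ⟹ claim"): if for all curve characters `β, γ ∈ 𝔄¹ₘ` with `β∗γ` Hodge there are
a span `X¹ₘ ⊗ X¹ₘ ←π— E —φ→ X⁴ₘ` of smooth projective varieties (`dim E = 3`, `π` flat) and a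
divisor class `K ∈ N¹H²(X¹ₘ × X¹ₘ)` with `π_{β∗γ}(φ_*(π^* K)) ≠ 0`, then claim(`β∗γ`) — the
assembly `Shioda1979_claim_semiDecomposable_of_join` with `dim V ≤ 1` supplied by
`Ran1980_fermatEigenspace_le_span_holds`. Residual obligation of
`Shioda1979_claim_semiDecomposable_holds` on this road: exactly the hypothesis `hjoin`.
[cite: Ran1980, §4 p. 139 and Cor. 4.7, Prop. 1.7 (i)] [cite: Aoki1987, p. 386]
[cite: Shioda1979PJA, §4] -/
theorem Shioda1979_claim_semiDecomposable_holds_of_join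
    (hjoin : ∀ (m : ℕ) [NeZero m] (β γ : Fin 3 → ZMod m),
      (∀ i, β i ≠ 0) → (∀ i, γ i ≠ 0) → ∑ i, β i = 0 → ∑ i, γ i = 0 →
      FermatCharacter.IsHodge (Fin.append β γ ∘ finCongr FermatCharacter.two_mul_two_add_two) →
      ∃ (μ : OrientationFamily) (e : ℕ) (E : Motives.SchemeOver ℂ) (hE : IsSmoothProjective e E)
        (hX : IsSmoothProjective (2 * 2) (fermatHypersurface (2 * 2) m))
        (π : E ⟶ fermatHypersurface 1 m ⊗ fermatHypersurface 1 m) (_ : Flat π.left)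
        (φ : E ⟶ fermatHypersurface (2 * 2) m) (he : e = 3),
        ∃ K ∈ algebraicClasses (fermatHypersurface 1 m ⊗ fermatHypersurface 1 m) 1,
          fermatProjector m (Fin.append β γ ∘ finCongr FermatCharacter.two_mul_two_add_two) (2 * 2)
            (complexGysin μ hE hX φ (show 2 * 1 + 2 * (2 * 2) = 2 * 2 + 2 * e by omega)
              (complexBetti.map π (2 * 1) K)) ≠ 0) :
    Shioda1979_claim_semiDecomposable :=
  Shioda1979_claim_semiDecomposable_of_join Ran1980_fermatEigenspace_le_span_holds hjoin

end Literature.AlgebraicGeometry.HodgeTheory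

end
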